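import Summits.Ventures.PackingBounds.SphericalCodes.DegreeFourEquality
import Mathlib.NumberTheory.Real.Irrational

/-!
# `A(13, arccos 1/3) ≤ 337`: Levenshtein's `L₅(13, 1/3) = 338` is not attained (the Galois step)

Framing: lottery ticket; floor = certified bounds/negative ranges. Venture `PackingBounds`
(cell `pub-packcert`), spherical-code family, grid cell `(13, 1/3)` — the one `L₅` cell whose
Galois-free forced valency is a natural number (`m = 117`), so that the irrationality of the nodes has
to be used.

The exact Delsarte value at `(13, 1/3)` is `338`, realised by `f(t) = (t - 1/3)(t² + (2/3)t + 1/15)²`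
(Gegenbauer coefficients below, `μ = 11/2`; the nodes `-1/3 ∓ √10/15` are irrational). If `|C| = 338`,
then at any `x ∈ C` (LP equality case): every `u = ⟨x,y⟩`, `y ≠ x`, is `1/3` or satisfies
`(u + 1/3)² = 2/45`, i.e. `u = -1/3 ± √10/15`; `Σ u = -1` and `Σ u² = 25` (balanced, 2-design). The
`1/3`-valency is then forced to be `117`, the other `220` neighbours have `Σ u = -40`, whence
`(#₊ - #₋) · √10/15 = 100/3` for the counts `#₊, #₋` of the two irrational values: `√10` would be
rational. Hence `|C| ≤ 337`. (Levenshtein 1992 / Boyvalenkov–Landgev 1995: codes attaining `L₅` carry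
the quadrature weights, here irrational; certified `L₅ − 1` row of the `pub-packcert` grid — no
three-point value exists in the cell for `n = 13`.)

## References
* V. I. Levenshtein, Acta Appl. Math. 29 (1992) 1–82.
* P. Delsarte, J. M. Goethals, J. J. Seidel, Geom. Dedicata 6 (1977) 363–388, §4. [`DelsarteGoethalsSeidel1977`]
-/

noncomputable section

namespace Summit.Ventures.PackingBounds.SphericalCodes

open Finset Literature.Analysis.SpecialFunctions Literature.Geometry.DiscreteGeometry
open scoped RealInnerProductSpace

set_option maxHeartbeats 400000 in
/-- **`A(13, arccos 1/3) ≤ 337`**: every finite set of unit vectors of `ℝ^13` with pairwise inner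
products `≤ 1/3` has at most `337` elements — Levenshtein's `L₅(13, 1/3) = 338` is not attained
(forced `1/3`-valency `117`, then `√10 ∈ ℚ` from the balanced-code identity on the `220` irrational
inner products). (LP equality case + irrationality of the nodes; certified `L₅ − 1` row.) -/
theorem code_dim13_third_le_337 (C : Finset (EuclideanSpace ℝ (Fin 13)))
    (h1 : ∀ x ∈ C, ‖x‖ = 1) (h2 : ∀ x ∈ C, ∀ y ∈ C, x ≠ y → inner ℝ x y ≤ 1 / 3) :
    C.card ≤ 337 := by
  classical
  -- the quintic certificate
  set f : ℕ → ℝ := fun k => match k with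
      | 0 => 4 / 675
      | 1 => 692 / 126225
      | 2 => 8 / 2295
      | 3 => 376 / 203775
      | 4 => 8 / 12155
      | 5 => 8 / 46189
      | _ => 0 with hfdef
  have hfac : ∀ t : ℝ, ∑ k ∈ range (5 + 1), f k * gegenbauerSum ((11 / 2 : ℝ)) k t =
      (t - 1 / 3) * (t ^ 2 + 2 / 3 * t + 1 / 15) ^ 2 := by
    intro t
    simp [hfdef, Finset.sum_range_succ, gegenbauerSum, gegenbauerCoeff, Finset.prod_range_succ,
      Nat.factorial]
    ring
  have hf : ∀ k, 0 ≤ f k := by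
    intro k; simp only [hfdef]; split <;> norm_num
  have hn : ((13 : ℕ) : ℝ) = 2 * (11 / 2 : ℝ) + 2 := by norm_num
  have hμ : (0 : ℝ) < 11 / 2 := by norm_num
  have hF : ∀ t : ℝ, -1 ≤ t → t ≤ 1 / 3 →
      ∑ k ∈ range (5 + 1), f k * gegenbauerSum ((11 / 2 : ℝ)) k t ≤ 0 := by
    intro t ht1 ht2
    rw [hfac]
    exact mul_nonpos_of_nonpos_of_nonneg (by linarith) (sq_nonneg _)
  -- LP bound: |C| ≤ 338
  have hle := DelsarteLP.card_mul_le hn hμ 5 f hf (1 / 3) hF C h1 h2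
  rw [hfac] at hle
  have hf0 : f 0 = 4 / 675 := rfl
  rw [hf0] at hle
  have hC : C.card ≤ 338 := by
    have : (C.card : ℝ) ≤ 338 := by nlinarith
    exact_mod_cast this
  rcases hC.lt_or_eq with hlt | heqN
  · omega
  exfalso
  obtain ⟨x, hx⟩ := Finset.card_pos.1 (by omega : 0 < C.card)
  have heq' : (C.card : ℝ) * f 0 = ∑ k ∈ range (5 + 1), f k * gegenbauerSum ((11 / 2 : ℝ)) k 1 := by
    rw [hfac, heqN, hf0]; norm_num
  -- roots
  have hroots : ∀ y ∈ C.erase x, inner ℝ x y = 1 / 3 ∨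
      inner ℝ x y = -1 / 3 + Real.sqrt 10 / 15 ∨ inner ℝ x y = -1 / 3 - Real.sqrt 10 / 15 := by
    intro y hy
    have hyC : y ∈ C := Finset.mem_of_mem_erase hy
    have hxy : x ≠ y := (Finset.ne_of_mem_erase hy).symm
    have h0 := DelsarteLP.sum_eq_zero_of_card_mul_eq hn hμ 5 f hf (1 / 3) hF C h1 h2 heq' hx hyC hxy
    rw [hfac] at h0
    rcases mul_eq_zero.1 h0 with h | h
    · left; linarith
    · right
      have hq : inner ℝ x y ^ 2 + 2 / 3 * inner ℝ x y + 1 / 15 = 0 :=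
        pow_eq_zero_iff (n := 2) (by norm_num) |>.1 h
      have h10 : Real.sqrt 10 ^ 2 = 10 := Real.sq_sqrt (by norm_num)
      have hsq : (inner ℝ x y + 1 / 3) ^ 2 = (Real.sqrt 10 / 15) ^ 2 := by nlinarith
      rcases sq_eq_sq_iff_eq_or_eq_neg.1 hsq with h' | h'
      · left; linarith
      · right; linarith
  -- balanced and 2-design at `x`
  have hbal : ∑ y ∈ C, inner ℝ x y = 0 :=
    sum_inner_eq_zero_of_card_mul_eq hn hμ 5 f hf (1 / 3) hF C h1 h2 heq' (by norm_num)
      (by rw [hfdef]; norm_num) x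
  have hdes : ∑ y ∈ C, inner ℝ x y ^ 2 = (C.card : ℝ) / (13 : ℕ) :=
    sum_inner_sq_eq_of_card_mul_eq hn hμ 5 f hf (1 / 3) hF C h1 h2 heq' (by norm_num)
      (by rw [hfdef]; norm_num) hx
  have hxx : inner ℝ x x = 1 := by
    rw [real_inner_self_eq_norm_sq, h1 x hx, one_pow]
  rw [← Finset.add_sum_erase C _ hx, hxx] at hbal
  rw [← Finset.add_sum_erase C _ hx, hxx, one_pow, heqN] at hdes
  -- three classes
  set r : ℝ := Real.sqrt 10 / 15 with hr
  set P := (C.erase x).filter fun y => inner ℝ x y = 1 / 3 with hP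
  set Qp := (C.erase x).filter fun y => inner ℝ x y = -1 / 3 + r with hQp
  set Qm := (C.erase x).filter fun y => inner ℝ x y = -1 / 3 - r with hQm
  have hrpos : 0 < r := by rw [hr]; positivity
  have hr2 : r ^ 2 = 2 / 45 := by
    rw [hr, div_pow, Real.sq_sqrt (by norm_num)]; norm_num
  -- the partition of `C.erase x` and the class sums, via indicator decomposition
  have hsum : ∀ g : ℝ → ℝ, ∑ y ∈ C.erase x, g (inner ℝ x y) =
      (P.card : ℝ) * g (1 / 3) + (Qp.card : ℝ) * g (-1 / 3 + r) + (Qm.card : ℝ) * g (-1 / 3 - r) := by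
    intro g
    have hdisj1 : Disjoint P (Qp ∪ Qm) := by
      rw [hP, hQp, hQm, Finset.disjoint_left]
      intro y hy hy'
      have e := (Finset.mem_filter.1 hy).2
      rcases Finset.mem_union.1 hy' with h | h
      · have e' := (Finset.mem_filter.1 h).2
        have : r = 2 / 3 := by linarith
        nlinarith
      · have e' := (Finset.mem_filter.1 h).2
        have : r = -(2 / 3) := by linarith
        linarith
    have hdisj2 : Disjoint Qp Qm := by
      rw [hQp, hQm, Finset.disjoint_filter]
      intro y _ e e'
      have : r = 0 := by linarith
      linarith
    have hunion : C.erase x = P ∪ (Qp ∪ Qm) := by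
      ext y
      simp only [hP, hQp, hQm, Finset.mem_union, Finset.mem_filter]
      constructor
      · intro hy
        rcases hroots y hy with h | h | h
        · exact Or.inl ⟨hy, h⟩
        · exact Or.inr (Or.inl ⟨hy, h⟩)
        · exact Or.inr (Or.inr ⟨hy, h⟩)
      · rintro (⟨hy, _⟩ | ⟨hy, _⟩ | ⟨hy, _⟩) <;> exact hy
    rw [hunion, Finset.sum_union hdisj1, Finset.sum_union hdisj2]
    have eP : ∑ y ∈ P, g (inner ℝ x y) = (P.card : ℝ) * g (1 / 3) := by
      rw [Finset.sum_congr rfl fun y hy => by rw [(Finset.mem_filter.1 hy).2], Finset.sum_const,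
        nsmul_eq_mul]
    have eQp : ∑ y ∈ Qp, g (inner ℝ x y) = (Qp.card : ℝ) * g (-1 / 3 + r) := by
      rw [Finset.sum_congr rfl fun y hy => by rw [(Finset.mem_filter.1 hy).2], Finset.sum_const,
        nsmul_eq_mul]
    have eQm : ∑ y ∈ Qm, g (inner ℝ x y) = (Qm.card : ℝ) * g (-1 / 3 - r) := by
      rw [Finset.sum_congr rfl fun y hy => by rw [(Finset.mem_filter.1 hy).2], Finset.sum_const,
        nsmul_eq_mul]
    rw [eP, eQp, eQm]; ring
  have hcardsum : (P.card : ℝ) + Qp.card + Qm.card = 337 := by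
    have h := hsum (fun _ => (1 : ℝ))
    rw [Finset.sum_const, nsmul_eq_mul, mul_one] at h
    have hc : ((C.erase x).card : ℝ) = 337 := by
      have := Finset.card_erase_add_one hx
      rw [heqN] at this
      have h' : (C.erase x).card = 337 := by omega
      exact_mod_cast h'
    linarith
  have hb := hbal
  rw [hsum (fun u => u)] at hb
  have hd := hdes
  rw [hsum (fun u => u ^ 2)] at hd
  -- expand the squares and solve: P.card = 117, Qp.card + Qm.card = 220, (Qp - Qm)·r = 100/3
  have e1 : (-1 / 3 + r) ^ 2 = 1 / 9 - 2 / 3 * r + r ^ 2 := by ring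
  have e2 : (-1 / 3 - r) ^ 2 = 1 / 9 + 2 / 3 * r + r ^ 2 := by ring
  rw [e1, e2, hr2] at hd
  norm_num at hb hd
  -- from hb, hd, hcardsum: eliminate
  have hdiff : ((Qp.card : ℝ) - Qm.card) * r = 100 / 3 := by nlinarith
  have hne : (Qp.card : ℤ) - Qm.card ≠ 0 := by
    intro h0
    have : ((Qp.card : ℝ) - Qm.card) = 0 := by exact_mod_cast h0
    rw [this, zero_mul] at hdiff; norm_num at hdiff
  have h10 : ¬ IsSquare (10 : ℕ) := by
    rintro ⟨r, hr⟩
    have hr4 : r < 4 := by nlinarith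
    interval_cases r <;> omega
  have hirr : Irrational (Real.sqrt 10) := by
    have := irrational_sqrt_natCast_iff.mpr h10
    simpa using this
  have hsqrt : Real.sqrt 10 = (500 : ℤ) / ((Qp.card : ℤ) - Qm.card : ℤ) := by
    have hd' : ((Qp.card : ℝ) - Qm.card) ≠ 0 := by exact_mod_cast hne
    rw [hr] at hdiff
    push_cast
    field_simp
    field_simp at hdiff
    linarith
  exact hirr.ne_rational 500 ((Qp.card : ℤ) - Qm.card) hsqrt

end Summit.Ventures.PackingBounds.SphericalCodes

end
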